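import Literature.NumberTheory.LFunctions.KloostermanFractionsComplementaryDivisor
import Literature.NumberTheory.LFunctions.KloostermanFractionsDiagonal
import Literature.NumberTheory.LFunctions.KloostermanFractionsCoprimeReduction
import HarnessLib

/-!
# Bilinear forms with Kloosterman fractions: eliminating `m` and Cauchy–Schwarz (B–C §4.1.1–4.1.2)

Topic `NumberTheory/LFunctions`.  S. Bettin, V. Chandee, *Trilinear forms with Kloosterman
fractions*, Adv. Math. 328 (2018), §4.1 (following Duke–Friedlander–Iwaniec, Invent. Math. 128
(1997)), case `𝔭ᵢ = 𝔮ᵢ = 1`, `A = 1`.  For the nondegenerate coprime part of the off-diagonal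
terms (`ℓ₁ ≠ ℓ₂`, `(n₁,n₂) = 1`, `(n₁n₂, ℓ₁ℓ₂) = 1`; the degenerate tuples are treated in
`KloostermanFractionsOffDiagDegenerate.lean`, the tuples with `(n₁,n₂) > 1` by rescaling),

  `𝒮 = ∑_{M₁<m≤M₂,(m,b)=1} ∑_{ℓ₁,ℓ₂∈𝓛, n₁,n₂≤2N' nondeg. coprime} [(ℓ₂n₂,m)=1, ℓ₁n₁≡ℓ₂n₂ (m)] c_m(n₁) conj c_m(n₂)`,

`c_m(n) = γ_n e(k m̄/(bn))`, this file PROVES (`kfs_S_norm_le`)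

  `‖𝒮‖ ≤ ‖γ‖² (#𝓛 φ(b))^{1/2} 𝒯^{1/2}`,
  `𝒯 = ∑_{ℓ₂∈𝓛} ∑_{n₁ : γ_{n₁} ≠ 0} ∑_{n₂ : γ_{n₂} ≠ 0} ∑_{c ∈ (ℤ/b)^*} |V(ℓ₂,n₁,n₂,c)|²`,
  `V = ∑_{ℓ₁ ∈ 𝓛 : nondeg. coprime} ∑_{0<|d|≤D : d ∣ w, M₁ < w/d ≤ M₂, w/d ≡ c (b)} e(-kd (bℓ₂n₂)‾/n₁) conj e(-kd (-bℓ₁n₁)‾/n₂)`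

(`w = ℓ₁n₁ - ℓ₂n₂`), following the source: (§4.1.1) switch to the complementary divisor `d`,
`md = w`, split `m` into classes `c (mod b)`, and rewrite the phase,
"`ϑ(m̄/(bn₁) - m̄/(bn₂)) ≡ ϑ(-d (bℓ̃₂𝔮₂n₂')‾/(𝔭₁n₁') - d (ℓ̃₁𝔭₁n₁'b𝔮₁)‾/(𝔮₂n₂') + (c𝔭₁n₁')‾/(b𝔭₂) - (c𝔮₂n₂')‾/(b𝔮₁))`"
(`kfs_msum_tuple_eq`, via `KloostermanFractionsComplementaryDivisor.lean`: the factors modulo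
`b` only depend on `(c, n₁, n₂)` and are unimodular); (§4.1.2) "we apply the Cauchy–Schwarz
inequality with respect to the sums over `𝔭₁,𝔭₂,𝔮₁,𝔮₂,n₁',n₂',c` … After squaring out, we get
`𝒮² ≪ M^ε‖β‖⁴‖ν‖² ∑ b𝔮₁𝔭₂ 𝒯`" — here with `ℓ₂` ALSO kept outside the Cauchy–Schwarz (so that
the two copies share `ℓ₂` and the case `(ℓ₁ℓ₁', ℓ₂ℓ₂') > 1` of §4.1.4 never arises), at the
price of the factor `#𝓛` in place of a longer diagonal later, and with the `n₁`- and `n₂`-ranges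
restricted to the support of `γ` (where the arithmetic hypotheses on `n₁` are available and
`n₂ > N'`; the Kloosterman-sum analysis enlarges the `n₂`-range again by positivity).

* `kfs_coprime_prods`, `kfs_ne_of_coprime`, `kfs_cond_iff_dvd` — in the coprime case
  `(ℓ₁n₁, ℓ₂n₂) = 1`, `w ≠ 0`, and `[(ℓ₂n₂,m)=1 ∧ ℓ₁n₁ ≡ ℓ₂n₂ (m)] = [m ∣ w]`;
* `kfs_msum_tuple_eq` — the `m`-sum of one tuple in terms of `d` and `c`;
* `kfs_norm_sum4_mul_le` — Cauchy–Schwarz (four-fold, from `DFI_norm_sum_mul_le_sqrt_mul_sqrt`);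
* `kfs_S_norm_le` — the bound above.

The phase is the section variable `e` with `he` as in `KloostermanFractionsDiagonal.lean`.

## References

* S. Bettin, V. Chandee, Adv. Math. 328 (2018) 1234–1262 (arXiv:1502.00769), §4.1.1 (vae),
  §4.1.2 (aae). [BettinChandee2018]
* W. Duke, J. Friedlander, H. Iwaniec, Invent. Math. 128 (1997) 23–43. [DukeFriedlanderIwaniec1997]
-/

noncomputable section

open Finset

namespace Literature.NumberTheory.LFunctions

section Phase

variable (e : ℤ → ℕ → ℕ → ℂ)
  (he : ∀ (k : ℤ) (q m : ℕ), e k q m = Complex.exp (2 * Real.pi * Complex.I *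
    ((k : ℂ) * ((((m : ZMod q)⁻¹).val : ℕ) : ℂ) / (q : ℂ))))

/-! ### The condition of an off-diagonal term in the coprime case is `m ∣ ℓ₁n₁ - ℓ₂n₂` -/

/-- In the nondegenerate coprime case (`ℓ₁ ≠ ℓ₂` primes, `(n₁,n₂) = 1`, `(n₁n₂, ℓ₁ℓ₂) = 1`) one has
`(ℓ₁n₁, ℓ₂n₂) = 1`. [folklore] -/
theorem kfs_coprime_prods {ℓ₁ ℓ₂ n₁ n₂ : ℕ} (hp₁ : ℓ₁.Prime) (hp₂ : ℓ₂.Prime) (hne : ℓ₁ ≠ ℓ₂)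
    (hn : n₁.Coprime n₂) (hnl : (n₁ * n₂).Coprime (ℓ₁ * ℓ₂)) :
    (ℓ₁ * n₁).Coprime (ℓ₂ * n₂) := by
  have h12 : ℓ₁.Coprime ℓ₂ := (Nat.coprime_primes hp₁ hp₂).mpr hne
  have h1 : n₁.Coprime ℓ₂ :=
    Nat.Coprime.coprime_mul_left_right (Nat.Coprime.coprime_mul_right hnl)
  have h2 : n₂.Coprime ℓ₁ :=
    Nat.Coprime.coprime_mul_right_right (Nat.Coprime.coprime_mul_left hnl)
  exact Nat.Coprime.mul_left (Nat.Coprime.mul_right h12 h2.symm) (Nat.Coprime.mul_right h1 hn)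

/-- In the nondegenerate coprime case, `ℓ₁n₁ ≠ ℓ₂n₂` (for `n₂ ≥ 1`... in fact always: the two
products are coprime and `ℓ₂n₂ > 1`). [folklore] -/
theorem kfs_ne_of_coprime {ℓ₁ ℓ₂ n₁ n₂ : ℕ} (hp₁ : ℓ₁.Prime) (hp₂ : ℓ₂.Prime) (hne : ℓ₁ ≠ ℓ₂)
    (hn : n₁.Coprime n₂) (hnl : (n₁ * n₂).Coprime (ℓ₁ * ℓ₂)) (hn₂ : 0 < n₂) :
    (ℓ₁ * n₁ : ℤ) - ℓ₂ * n₂ ≠ 0 := by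
  intro h
  have heq : ℓ₁ * n₁ = ℓ₂ * n₂ := by exact_mod_cast (sub_eq_zero.mp h)
  have hcop := kfs_coprime_prods hp₁ hp₂ hne hn hnl
  rw [heq, Nat.coprime_self] at hcop
  have : 1 < ℓ₂ * n₂ := lt_of_lt_of_le hp₂.one_lt (Nat.le_mul_of_pos_right _ hn₂)
  omega

/-- For `m` coprime to `b`... (no `b` needed): in the coprime case the condition
`(ℓ₂n₂, m) = 1 ∧ ℓ₁n₁ ≡ ℓ₂n₂ (mod m)` is equivalent to `m ∣ ℓ₁n₁ - ℓ₂n₂`. [folklore] -/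
theorem kfs_cond_iff_dvd {ℓ₁ ℓ₂ n₁ n₂ : ℕ} (hcop : (ℓ₁ * n₁).Coprime (ℓ₂ * n₂)) (m : ℕ) :
    ((ℓ₂ * n₂).Coprime m ∧ ((ℓ₁ * n₁ : ℕ) : ZMod m) = ((ℓ₂ * n₂ : ℕ) : ZMod m)) ↔
      (m : ℤ) ∣ (ℓ₁ * n₁ : ℤ) - ℓ₂ * n₂ := by
  have hcong : ((ℓ₁ * n₁ : ℕ) : ZMod m) = ((ℓ₂ * n₂ : ℕ) : ZMod m) ↔
      (m : ℤ) ∣ (ℓ₁ * n₁ : ℤ) - ℓ₂ * n₂ := by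
    rw [← Int.cast_natCast (R := ZMod m) (ℓ₁ * n₁), ← Int.cast_natCast (R := ZMod m) (ℓ₂ * n₂),
      eq_comm, ZMod.intCast_eq_intCast_iff_dvd_sub]
    push_cast
    exact Iff.rfl
  constructor
  · exact fun h => hcong.mp h.2
  · intro h
    refine ⟨?_, hcong.mpr h⟩
    -- `(ℓ₂n₂, m) ∣ ℓ₁n₁` and `∣ ℓ₂n₂`
    have hg1 : ((Nat.gcd (ℓ₂ * n₂) m : ℕ) : ℤ) ∣ (ℓ₁ * n₁ : ℤ) := by
      have h1 : ((Nat.gcd (ℓ₂ * n₂) m : ℕ) : ℤ) ∣ (m : ℤ) :=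
        Int.natCast_dvd_natCast.mpr (Nat.gcd_dvd_right _ _)
      have h2 : ((Nat.gcd (ℓ₂ * n₂) m : ℕ) : ℤ) ∣ (ℓ₂ * n₂ : ℤ) := by
        exact_mod_cast (Int.natCast_dvd_natCast.mpr (Nat.gcd_dvd_left (ℓ₂ * n₂) m))
      have h3 := (h1.trans h)
      have : (ℓ₁ * n₁ : ℤ) = ((ℓ₁ * n₁ : ℤ) - ℓ₂ * n₂) + ℓ₂ * n₂ := by ring
      rw [this]
      exact dvd_add h3 h2
    have hg1' : Nat.gcd (ℓ₂ * n₂) m ∣ ℓ₁ * n₁ := by exact_mod_cast hg1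
    have hg2 : Nat.gcd (ℓ₂ * n₂) m ∣ ℓ₂ * n₂ := Nat.gcd_dvd_left _ _
    have : Nat.gcd (ℓ₂ * n₂) m ∣ Nat.gcd (ℓ₁ * n₁) (ℓ₂ * n₂) := Nat.dvd_gcd hg1' hg2
    rw [Nat.Coprime.gcd_eq_one hcop, Nat.dvd_one] at this
    exact this


/-- If `q₀ d = ℓ₁n₁ - ℓ₂n₂` and `(ℓ₂n₂, n₁) = 1` then `(q₀, n₁) = 1`. [folklore] -/
theorem kfs_gcd_quot_left {ℓ₁ ℓ₂ n₁ n₂ : ℕ} (h : (ℓ₂ * n₂).Coprime n₁) {q₀ d : ℤ}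
    (hq : q₀ * d = (ℓ₁ * n₁ : ℤ) - ℓ₂ * n₂) : Int.gcd q₀ n₁ = 1 := by
  set g : ℕ := Int.gcd q₀ n₁ with hg
  have h1 : (g : ℤ) ∣ q₀ := Int.gcd_dvd_left _ _
  have h2 : (g : ℤ) ∣ (n₁ : ℤ) := Int.gcd_dvd_right _ _
  have h3 : (g : ℤ) ∣ (ℓ₂ * n₂ : ℤ) := by
    have h4 : (g : ℤ) ∣ (ℓ₁ * n₁ : ℤ) - ℓ₂ * n₂ := by rw [← hq]; exact h1.mul_right d
    have h5 : (g : ℤ) ∣ (ℓ₁ * n₁ : ℤ) := (h2.mul_left (ℓ₁ : ℤ))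
    have : (ℓ₂ * n₂ : ℤ) = ℓ₁ * n₁ - ((ℓ₁ * n₁ : ℤ) - ℓ₂ * n₂) := by ring
    rw [this]; exact dvd_sub h5 h4
  have h3' : g ∣ ℓ₂ * n₂ := by exact_mod_cast h3
  have h2' : g ∣ n₁ := by exact_mod_cast h2
  have : g ∣ Nat.gcd (ℓ₂ * n₂) n₁ := Nat.dvd_gcd h3' h2'
  rwa [Nat.Coprime.gcd_eq_one h, Nat.dvd_one] at this

/-- If `q₀ d = ℓ₁n₁ - ℓ₂n₂` and `(ℓ₁n₁, n₂) = 1` then `(q₀, n₂) = 1`. [folklore] -/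
theorem kfs_gcd_quot_right {ℓ₁ ℓ₂ n₁ n₂ : ℕ} (h : (ℓ₁ * n₁).Coprime n₂) {q₀ d : ℤ}
    (hq : q₀ * d = (ℓ₁ * n₁ : ℤ) - ℓ₂ * n₂) : Int.gcd q₀ n₂ = 1 := by
  set g : ℕ := Int.gcd q₀ n₂ with hg
  have h1 : (g : ℤ) ∣ q₀ := Int.gcd_dvd_left _ _
  have h2 : (g : ℤ) ∣ (n₂ : ℤ) := Int.gcd_dvd_right _ _
  have h3 : (g : ℤ) ∣ (ℓ₁ * n₁ : ℤ) := by
    have h4 : (g : ℤ) ∣ (ℓ₁ * n₁ : ℤ) - ℓ₂ * n₂ := by rw [← hq]; exact h1.mul_right d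
    have h5 : (g : ℤ) ∣ (ℓ₂ * n₂ : ℤ) := (h2.mul_left (ℓ₂ : ℤ))
    have : (ℓ₁ * n₁ : ℤ) = ((ℓ₁ * n₁ : ℤ) - ℓ₂ * n₂) + ℓ₂ * n₂ := by ring
    rw [this]; exact dvd_add h4 h5
  have h3' : g ∣ ℓ₁ * n₁ := by exact_mod_cast h3
  have h2' : g ∣ n₂ := by exact_mod_cast h2
  have : g ∣ Nat.gcd (ℓ₁ * n₁) n₂ := Nat.dvd_gcd h3' h2'
  rwa [Nat.Coprime.gcd_eq_one h, Nat.dvd_one] at this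

/-! ### One tuple: the `m`-sum in terms of `d` and the classes `c (mod b)` -/

include he in
/-- **Eliminating `m` for one nondegenerate coprime tuple** (Bettin–Chandee §4.1.1 (vae), case
`𝔭ᵢ = 𝔮ᵢ = 1`, `A = 1`): for `ℓ₁ ≠ ℓ₂` primes, `(n₁, n₂) = 1`, `(n₁n₂, ℓ₁ℓ₂) = 1`,
`(n₁, b) = (n₂, b) = 1`, `w = ℓ₁n₁ - ℓ₂n₂`, `|w| ≤ D(M₁+1)`:
`∑_{M₁<m≤M₂,(m,b)=1} [(ℓ₂n₂,m)=1, ℓ₁n₁≡ℓ₂n₂ (m)] γ_{n₁} e(k m̄/(bn₁)) conj(γ_{n₂} e(k m̄/(bn₂)))`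
`= γ_{n₁} conj γ_{n₂} ∑_{c ∈ (ℤ/b)^*} Ψ_c ∑_{0<|d|≤D : d∣w, M₁<w/d≤M₂, w/d≡c (b)} e(-kd (bℓ₂n₂)‾/n₁) conj e(-kd (-bℓ₁n₁)‾/n₂)`
with `Ψ_c = e(k (cn₁)‾^{(b)}/b) conj e(k (cn₂)‾^{(b)}/b)`. [cite: BettinChandee2018, §4.1.1] -/
theorem kfs_msum_tuple_eq (k : ℤ) {b : ℕ} (hb : 0 < b) (γ : ℕ → ℂ) (M₁ M₂ D : ℕ)
    {ℓ₁ ℓ₂ n₁ n₂ : ℕ} (hp₁ : ℓ₁.Prime) (hp₂ : ℓ₂.Prime) (hne : ℓ₁ ≠ ℓ₂) (hn : n₁.Coprime n₂)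
    (hnl : (n₁ * n₂).Coprime (ℓ₁ * ℓ₂)) (hn₁ : 0 < n₁) (hn₂ : 0 < n₂) (hb₁ : n₁.Coprime b)
    (hb₂ : n₂.Coprime b) (hD : ((ℓ₁ * n₁ : ℤ) - ℓ₂ * n₂).natAbs ≤ D * (M₁ + 1)) :
    ∑ m ∈ (Ioc M₁ M₂).filter (fun m => m.Coprime b),
        (if (ℓ₂ * n₂).Coprime m ∧ ((ℓ₁ * n₁ : ℕ) : ZMod m) = ((ℓ₂ * n₂ : ℕ) : ZMod m) then
          γ n₁ * e k (b * n₁) m * (starRingEnd ℂ) (γ n₂ * e k (b * n₂) m) else 0) =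
      γ n₁ * (starRingEnd ℂ) (γ n₂) *
        ∑ c ∈ (Finset.range b).filter (fun c => c.Coprime b),
          (Complex.exp (2 * Real.pi * Complex.I *
              ((k : ℂ) * ((((((c : ℤ) * n₁ : ℤ) : ZMod b)⁻¹).val : ℕ) : ℂ) / (b : ℂ))) *
            (starRingEnd ℂ) (Complex.exp (2 * Real.pi * Complex.I *
              ((k : ℂ) * ((((((c : ℤ) * n₂ : ℤ) : ZMod b)⁻¹).val : ℕ) : ℂ) / (b : ℂ))))) *
          ∑ d ∈ (Icc (-(D : ℤ)) D).erase 0,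
            (if d ∣ ((ℓ₁ * n₁ : ℤ) - ℓ₂ * n₂) ∧ (M₁ : ℤ) < ((ℓ₁ * n₁ : ℤ) - ℓ₂ * n₂) / d ∧
                ((ℓ₁ * n₁ : ℤ) - ℓ₂ * n₂) / d ≤ M₂ ∧
                ((ℓ₁ * n₁ : ℤ) - ℓ₂ * n₂) / d ≡ (c : ℤ) [ZMOD b] then
              Complex.exp (2 * Real.pi * Complex.I *
                  (((-(k * d) : ℤ) : ℂ) * (((((b * (ℓ₂ * n₂ : ℤ) : ℤ) : ZMod n₁)⁻¹).val : ℕ) : ℂ) /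
                    (n₁ : ℂ))) *
                (starRingEnd ℂ) (Complex.exp (2 * Real.pi * Complex.I *
                  (((-(k * d) : ℤ) : ℂ) *
                    (((((b * (-(ℓ₁ * n₁ : ℤ)) : ℤ) : ZMod n₂)⁻¹).val : ℕ) : ℂ) / (n₂ : ℂ))))
            else 0) := by
  classical
  set w : ℤ := (ℓ₁ * n₁ : ℤ) - ℓ₂ * n₂ with hw
  have hw0 : w ≠ 0 := kfs_ne_of_coprime hp₁ hp₂ hne hn hnl hn₂
  have hcopp := kfs_coprime_prods hp₁ hp₂ hne hn hnl
  -- notation for the phases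
  set P : ℤ → ℂ := fun x => Complex.exp (2 * Real.pi * Complex.I *
    ((k : ℂ) * ((((x : ZMod b)⁻¹).val : ℕ) : ℂ) / (b : ℂ))) with hP
  set Q₁ : ℤ → ℂ := fun d => Complex.exp (2 * Real.pi * Complex.I *
    (((-(k * d) : ℤ) : ℂ) * (((((b * (ℓ₂ * n₂ : ℤ) : ℤ) : ZMod n₁)⁻¹).val : ℕ) : ℂ) /
      (n₁ : ℂ))) with hQ₁
  set Q₂ : ℤ → ℂ := fun d => Complex.exp (2 * Real.pi * Complex.I *
    (((-(k * d) : ℤ) : ℂ) * (((((b * (-(ℓ₁ * n₁ : ℤ)) : ℤ) : ZMod n₂)⁻¹).val : ℕ) : ℂ) /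
      (n₂ : ℂ))) with hQ₂
  set F : ℕ → ℂ := fun m => γ n₁ * e k (b * n₁) m * (starRingEnd ℂ) (γ n₂ * e k (b * n₂) m)
    with hF
  -- Step 1: the condition is `m ∣ w`
  have h1 : ∀ m, (if (ℓ₂ * n₂).Coprime m ∧ ((ℓ₁ * n₁ : ℕ) : ZMod m) = ((ℓ₂ * n₂ : ℕ) : ZMod m)
      then γ n₁ * e k (b * n₁) m * (starRingEnd ℂ) (γ n₂ * e k (b * n₂) m) else 0) =
      (if (m : ℤ) ∣ w then F m else 0) := by
    intro m
    by_cases h : (m : ℤ) ∣ w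
    · rw [if_pos h, if_pos ((kfs_cond_iff_dvd hcopp m).mpr h)]
    · rw [if_neg h, if_neg (fun h' => h ((kfs_cond_iff_dvd hcopp m).mp h'))]
  rw [Finset.sum_congr rfl (fun m _ => h1 m), kfs_msum_eq_dsum hw0 b M₁ M₂ D hD F]
  -- Step 2: expand the right-hand side and compare termwise in `d`
  rw [Finset.mul_sum]
  simp_rw [Finset.mul_sum]
  rw [Finset.sum_comm]
  refine Finset.sum_congr rfl fun d hd => ?_
  have hd0 : d ≠ 0 := (Finset.mem_erase.mp hd).1
  by_cases hA : d ∣ w ∧ (M₁ : ℤ) < w / d ∧ w / d ≤ M₂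
  · obtain ⟨hdw, hM1, hM2⟩ := hA
    set q₀ : ℤ := w / d with hq₀
    have hq₀d : q₀ * d = w := Int.ediv_mul_cancel hdw
    have hq₀0 : 0 ≤ q₀ := le_trans (by positivity) hM1.le
    have hm' : ((q₀.toNat : ℕ) : ℤ) = q₀ := Int.toNat_of_nonneg hq₀0
    -- the class sum collapses
    have hclass : ∑ c ∈ (Finset.range b).filter (fun c => c.Coprime b),
        (if q₀ ≡ (c : ℤ) [ZMOD b] then P ((c : ℤ) * n₁) * (starRingEnd ℂ) (P ((c : ℤ) * n₂))
          else 0) =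
        if Int.gcd q₀ b = 1 then P (q₀ * n₁) * (starRingEnd ℂ) (P (q₀ * n₂)) else 0 := by
      have hsc := kfs_split_classes hb q₀
        (fun c => P ((c : ℤ) * n₁) * (starRingEnd ℂ) (P ((c : ℤ) * n₂)))
      beta_reduce at hsc
      rw [← hsc]
      by_cases hg : Int.gcd q₀ b = 1
      · rw [if_pos hg, if_pos hg]
        have hmod : q₀ ≡ ((q₀ % b).toNat : ℤ) [ZMOD b] := by
          rw [Int.toNat_of_nonneg (Int.emod_nonneg _ (by exact_mod_cast hb.ne'))]
          exact (Int.emod_emod_of_dvd _ (dvd_refl _)).symm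
        simp only [hP]
        rw [kfs_phase_mod_b k b n₁ hmod, kfs_phase_mod_b k b n₂ hmod]
      · rw [if_neg hg, if_neg hg]
    -- the left-hand side in factored form
    have hLHS : (if d ∣ w ∧ (M₁ : ℤ) < w / d ∧ w / d ≤ M₂ ∧ Int.gcd (w / d) b = 1 then
        F (w / d).toNat else 0) =
        γ n₁ * (starRingEnd ℂ) (γ n₂) * ((if Int.gcd q₀ b = 1 then
          P (q₀ * n₁) * (starRingEnd ℂ) (P (q₀ * n₂)) else 0) * (Q₁ d * (starRingEnd ℂ) (Q₂ d))) := by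
      by_cases hg : Int.gcd q₀ b = 1
      · rw [if_pos ⟨hdw, hM1, hM2, hg⟩, if_pos hg]
        -- coprimality of `m' = q₀` with `b n₁` and `b n₂`
        have hc1 : (q₀.toNat).Coprime (b * n₁) := by
          refine Nat.Coprime.mul_right ?_ ?_
          · rw [Nat.coprime_iff_gcd_eq_one, ← Int.gcd_natCast_natCast, hm']; exact hg
          · rw [Nat.coprime_iff_gcd_eq_one, ← Int.gcd_natCast_natCast, hm']
            exact kfs_gcd_quot_left (Nat.Coprime.coprime_mul_left_right hcopp.symm) hq₀d
        have hc2 : (q₀.toNat).Coprime (b * n₂) := by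
          refine Nat.Coprime.mul_right ?_ ?_
          · rw [Nat.coprime_iff_gcd_eq_one, ← Int.gcd_natCast_natCast, hm']; exact hg
          · rw [Nat.coprime_iff_gcd_eq_one, ← Int.gcd_natCast_natCast, hm']
            exact kfs_gcd_quot_right (Nat.Coprime.coprime_mul_left_right hcopp) hq₀d
        -- units for the substitution
        have hu1 : IsUnit ((b * (ℓ₂ * n₂ : ℤ) : ℤ) : ZMod n₁) := by
          have : ((b * (ℓ₂ * n₂ : ℤ) : ℤ) : ZMod n₁) = ((b * (ℓ₂ * n₂) : ℕ) : ZMod n₁) := by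
            push_cast; ring
          rw [this, ZMod.isUnit_iff_coprime]
          exact Nat.Coprime.mul_left hb₁.symm (Nat.Coprime.coprime_mul_left_right hcopp.symm)
        have hu2 : IsUnit ((b * (-(ℓ₁ * n₁ : ℤ)) : ℤ) : ZMod n₂) := by
          have : ((b * (-(ℓ₁ * n₁ : ℤ)) : ℤ) : ZMod n₂) = -((b * (ℓ₁ * n₁) : ℕ) : ZMod n₂) := by
            push_cast; ring
          rw [this, IsUnit.neg_iff, ZMod.isUnit_iff_coprime]
          exact Nat.Coprime.mul_left hb₂.symm (Nat.Coprime.coprime_mul_left_right hcopp)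
        have hdvd1 : (n₁ : ℤ) ∣ w + (ℓ₂ * n₂ : ℤ) := ⟨ℓ₁, by rw [hw]; ring⟩
        have hdvd2 : (n₂ : ℤ) ∣ w + (-(ℓ₁ * n₁ : ℤ)) := ⟨-ℓ₂, by rw [hw]; ring⟩
        -- the two phases
        have he1 : e k (b * n₁) q₀.toNat = P (q₀ * n₁) * Q₁ d := by
          rw [he, kfs_phase_factor k hb hn₁ hb₁.symm hc1, hm',
            kfs_phase_subst k hn₁ (b := b) hq₀d hdvd1 hu1]
        have he2 : e k (b * n₂) q₀.toNat = P (q₀ * n₂) * Q₂ d := by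
          rw [he, kfs_phase_factor k hb hn₂ hb₂.symm hc2, hm',
            kfs_phase_subst k hn₂ (b := b) hq₀d hdvd2 hu2]
        simp only [hF]
        rw [he1, he2]
        simp only [map_mul]
        ring
      · have : ¬ (d ∣ w ∧ (M₁ : ℤ) < w / d ∧ w / d ≤ M₂ ∧ Int.gcd (w / d) b = 1) :=
          fun h => hg h.2.2.2
        rw [if_neg this, if_neg hg]
        ring
    rw [hLHS, ← hclass, Finset.sum_mul, Finset.mul_sum]
    refine Finset.sum_congr rfl fun c _ => ?_
    by_cases hc : q₀ ≡ (c : ℤ) [ZMOD b]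
    · rw [if_pos hc, if_pos ⟨hdw, hM1, hM2, hc⟩]
    · have : ¬ (d ∣ w ∧ (M₁ : ℤ) < w / d ∧ w / d ≤ M₂ ∧ w / d ≡ (c : ℤ) [ZMOD b]) :=
        fun h => hc h.2.2.2
      rw [if_neg hc, if_neg this]
      ring
  · -- `d` does not contribute on either side
    have hL : ¬ (d ∣ w ∧ (M₁ : ℤ) < w / d ∧ w / d ≤ M₂ ∧ Int.gcd (w / d) b = 1) :=
      fun h => hA ⟨h.1, h.2.1, h.2.2.1⟩
    rw [if_neg hL]
    symm
    refine Finset.sum_eq_zero fun c _ => ?_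
    have : ¬ (d ∣ w ∧ (M₁ : ℤ) < w / d ∧ w / d ≤ M₂ ∧ w / d ≡ (c : ℤ) [ZMOD b]) :=
      fun h => hA ⟨h.1, h.2.1, h.2.2.1⟩
    rw [if_neg this]
    ring


/-! ### Cauchy–Schwarz over `(ℓ₂, n₁, n₂, c)` -/

/-- Cauchy–Schwarz for a four-fold sum. [folklore] -/
theorem kfs_norm_sum4_mul_le (A B C D : Finset ℕ) (a X : ℕ → ℕ → ℕ → ℕ → ℂ) :
    ‖∑ i ∈ A, ∑ j ∈ B, ∑ u ∈ C, ∑ v ∈ D, a i j u v * X i j u v‖ ≤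
      Real.sqrt (∑ i ∈ A, ∑ j ∈ B, ∑ u ∈ C, ∑ v ∈ D, ‖a i j u v‖ ^ 2) *
        Real.sqrt (∑ i ∈ A, ∑ j ∈ B, ∑ u ∈ C, ∑ v ∈ D, ‖X i j u v‖ ^ 2) := by
  have h := DFI_norm_sum_mul_le_sqrt_mul_sqrt (((A ×ˢ B) ×ˢ C) ×ˢ D)
    (fun x => a x.1.1.1 x.1.1.2 x.1.2 x.2) (fun x => X x.1.1.1 x.1.1.2 x.1.2 x.2)
  simpa only [Finset.sum_product] using h

include he in
/-- **Eliminating `m` and Cauchy–Schwarz** (Bettin–Chandee §4.1.1–§4.1.2, case `𝔭ᵢ = 𝔮ᵢ = 1`,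
`A = 1`, with `ℓ₂` kept OUTSIDE the Cauchy–Schwarz).  Let `b ≥ 1`, `γ` supported on `n` coprime
to `b`, `𝓛` a set of primes in `(L, 2L]`, `N' ≥ 1/2`, `M₁ ≤ M₂` and `D` with `4LN' ≤ D(M₁+1)`.
The nondegenerate coprime part of the off-diagonal sum,
`𝒮 := ∑_{M₁<m≤M₂,(m,b)=1} ∑_{ℓ₁≠ℓ₂, (n₁,n₂)=1, (n₁n₂,ℓ₁ℓ₂)=1} [(ℓ₂n₂,m)=1, ℓ₁n₁≡ℓ₂n₂ (m)] c_m(n₁) conj c_m(n₂)`,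
satisfies `‖𝒮‖ ≤ ‖γ‖² (#𝓛 φ(b))^{1/2} 𝒯^{1/2}` with
`𝒯 = ∑_{ℓ₂∈𝓛} ∑_{n₁: γ_{n₁}≠0} ∑_{n₂: γ_{n₂}≠0} ∑_{c∈(ℤ/b)^*} |∑_{ℓ₁∈𝓛, ℓ₁≠ℓ₂, (n₁,n₂)=1, (n₁n₂,ℓ₁ℓ₂)=1}`
`  ∑_{0<|d|≤D : d∣w, M₁<w/d≤M₂, w/d≡c (b)} e(-kd (bℓ₂n₂)‾/n₁) conj e(-kd (-bℓ₁n₁)‾/n₂)|²`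
(`w = ℓ₁n₁ - ℓ₂n₂`).  The source: "we apply the Cauchy–Schwarz inequality with respect to the sums
over `𝔭₁,𝔭₂,𝔮₁,𝔮₂,n₁',n₂',c,a₂`. After squaring out, we get `𝒮² ≪ M^ε ‖β‖⁴‖ν‖² ∑ b𝔮₁𝔭₂ 𝒯`".
[cite: BettinChandee2018, §4.1.2 (aae)] -/
theorem kfs_S_norm_le (k : ℤ) {b : ℕ} (hb : 0 < b) (γ : ℕ → ℂ)
    (hγb : ∀ n, γ n ≠ 0 → n.Coprime b) {L : ℕ} (𝓛 : Finset ℕ)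
    (h𝓛 : ∀ ℓ ∈ 𝓛, ℓ.Prime ∧ L < ℓ ∧ ℓ ≤ 2 * L) {N' : ℝ} (hN' : 1 / 2 ≤ N') (M₁ M₂ D : ℕ)
    (hD : 4 * (L : ℝ) * N' ≤ (D : ℝ) * (M₁ + 1)) :
    ‖∑ m ∈ (Ioc M₁ M₂).filter (fun m => m.Coprime b),
        ∑ ℓ₁ ∈ 𝓛, ∑ n₁ ∈ Icc 1 ⌊2 * N'⌋₊, ∑ ℓ₂ ∈ 𝓛, ∑ n₂ ∈ Icc 1 ⌊2 * N'⌋₊,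
          (if (ℓ₁ ≠ ℓ₂ ∧ n₁.Coprime n₂ ∧ (n₁ * n₂).Coprime (ℓ₁ * ℓ₂)) then
            (if (ℓ₂ * n₂).Coprime m ∧ ((ℓ₁ * n₁ : ℕ) : ZMod m) = ((ℓ₂ * n₂ : ℕ) : ZMod m) then
              γ n₁ * e k (b * n₁) m * (starRingEnd ℂ) (γ n₂ * e k (b * n₂) m) else 0)
          else 0)‖ ≤
      (∑ n ∈ Icc 1 ⌊2 * N'⌋₊, ‖γ n‖ ^ 2) *
        Real.sqrt (𝓛.card * ((Finset.range b).filter (fun c => c.Coprime b)).card) *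
        Real.sqrt (∑ ℓ₂ ∈ 𝓛, ∑ n₁ ∈ (Icc 1 ⌊2 * N'⌋₊).filter (fun n => γ n ≠ 0),
          ∑ n₂ ∈ (Icc 1 ⌊2 * N'⌋₊).filter (fun n => γ n ≠ 0),
          ∑ c ∈ (Finset.range b).filter (fun c => c.Coprime b),
          ‖∑ ℓ₁ ∈ 𝓛, (if (ℓ₁ ≠ ℓ₂ ∧ n₁.Coprime n₂ ∧ (n₁ * n₂).Coprime (ℓ₁ * ℓ₂)) then
            ∑ d ∈ (Icc (-(D : ℤ)) D).erase 0,
              (if d ∣ ((ℓ₁ * n₁ : ℤ) - ℓ₂ * n₂) ∧ (M₁ : ℤ) < ((ℓ₁ * n₁ : ℤ) - ℓ₂ * n₂) / d ∧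
                  ((ℓ₁ * n₁ : ℤ) - ℓ₂ * n₂) / d ≤ M₂ ∧
                  ((ℓ₁ * n₁ : ℤ) - ℓ₂ * n₂) / d ≡ (c : ℤ) [ZMOD b] then
                Complex.exp (2 * Real.pi * Complex.I *
                    (((-(k * d) : ℤ) : ℂ) *
                      (((((b * (ℓ₂ * n₂ : ℤ) : ℤ) : ZMod n₁)⁻¹).val : ℕ) : ℂ) / (n₁ : ℂ))) *
                  (starRingEnd ℂ) (Complex.exp (2 * Real.pi * Complex.I *
                    (((-(k * d) : ℤ) : ℂ) *
                      (((((b * (-(ℓ₁ * n₁ : ℤ)) : ℤ) : ZMod n₂)⁻¹).val : ℕ) : ℂ) / (n₂ : ℂ))))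
              else 0)
            else 0)‖ ^ 2) := by
  classical
  set I := Icc 1 ⌊2 * N'⌋₊ with hI
  set Cb := (Finset.range b).filter (fun c => c.Coprime b) with hCb
  set Dset := (Icc (-(D : ℤ)) D).erase 0 with hDset
  -- the inner objects
  set Ψ : ℕ → ℕ → ℕ → ℂ := fun c n₁ n₂ =>
    Complex.exp (2 * Real.pi * Complex.I *
        ((k : ℂ) * ((((((c : ℤ) * n₁ : ℤ) : ZMod b)⁻¹).val : ℕ) : ℂ) / (b : ℂ))) *
      (starRingEnd ℂ) (Complex.exp (2 * Real.pi * Complex.I *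
        ((k : ℂ) * ((((((c : ℤ) * n₂ : ℤ) : ZMod b)⁻¹).val : ℕ) : ℂ) / (b : ℂ)))) with hΨ
  set Sd : ℕ → ℕ → ℕ → ℕ → ℕ → ℂ := fun ℓ₁ ℓ₂ n₁ n₂ c =>
    ∑ d ∈ Dset,
      (if d ∣ ((ℓ₁ * n₁ : ℤ) - ℓ₂ * n₂) ∧ (M₁ : ℤ) < ((ℓ₁ * n₁ : ℤ) - ℓ₂ * n₂) / d ∧
          ((ℓ₁ * n₁ : ℤ) - ℓ₂ * n₂) / d ≤ M₂ ∧
          ((ℓ₁ * n₁ : ℤ) - ℓ₂ * n₂) / d ≡ (c : ℤ) [ZMOD b] then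
        Complex.exp (2 * Real.pi * Complex.I *
            (((-(k * d) : ℤ) : ℂ) *
              (((((b * (ℓ₂ * n₂ : ℤ) : ℤ) : ZMod n₁)⁻¹).val : ℕ) : ℂ) / (n₁ : ℂ))) *
          (starRingEnd ℂ) (Complex.exp (2 * Real.pi * Complex.I *
            (((-(k * d) : ℤ) : ℂ) *
              (((((b * (-(ℓ₁ * n₁ : ℤ)) : ℤ) : ZMod n₂)⁻¹).val : ℕ) : ℂ) / (n₂ : ℂ))))
      else 0) with hSd
  set V : ℕ → ℕ → ℕ → ℕ → ℂ := fun ℓ₂ n₁ n₂ c =>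
    ∑ ℓ₁ ∈ 𝓛, (if (ℓ₁ ≠ ℓ₂ ∧ n₁.Coprime n₂ ∧ (n₁ * n₂).Coprime (ℓ₁ * ℓ₂)) then
      Sd ℓ₁ ℓ₂ n₁ n₂ c else 0) with hV
  have hΨn : ∀ c n₁ n₂, ‖Ψ c n₁ n₂‖ = 1 := by
    intro c n₁ n₂
    simp only [hΨ]
    rw [norm_mul, RCLike.norm_conj]
    have h1 : ∀ (n : ℕ), ‖Complex.exp (2 * Real.pi * Complex.I *
        ((k : ℂ) * ((((((c : ℤ) * n : ℤ) : ZMod b)⁻¹).val : ℕ) : ℂ) / (b : ℂ)))‖ = 1 := by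
      intro n
      have h : 2 * (Real.pi : ℂ) * Complex.I *
          ((k : ℂ) * ((((((c : ℤ) * n : ℤ) : ZMod b)⁻¹).val : ℕ) : ℂ) / (b : ℂ)) =
          (((2 * Real.pi * ((k : ℝ) * ((((((c : ℤ) * n : ℤ) : ZMod b)⁻¹).val : ℕ) : ℝ) /
            (b : ℝ)) : ℝ)) : ℂ) * Complex.I := by
        push_cast; ring
      rw [h, Complex.norm_exp_ofReal_mul_I]
    rw [h1, h1, mul_one]
  -- Step A/B: eliminate `m` tuple by tuple
  have hAB : ∑ m ∈ (Ioc M₁ M₂).filter (fun m => m.Coprime b),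
      ∑ ℓ₁ ∈ 𝓛, ∑ n₁ ∈ I, ∑ ℓ₂ ∈ 𝓛, ∑ n₂ ∈ I,
        (if (ℓ₁ ≠ ℓ₂ ∧ n₁.Coprime n₂ ∧ (n₁ * n₂).Coprime (ℓ₁ * ℓ₂)) then
          (if (ℓ₂ * n₂).Coprime m ∧ ((ℓ₁ * n₁ : ℕ) : ZMod m) = ((ℓ₂ * n₂ : ℕ) : ZMod m) then
            γ n₁ * e k (b * n₁) m * (starRingEnd ℂ) (γ n₂ * e k (b * n₂) m) else 0)
        else 0) =
      ∑ ℓ₁ ∈ 𝓛, ∑ n₁ ∈ I, ∑ ℓ₂ ∈ 𝓛, ∑ n₂ ∈ I,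
        (if (ℓ₁ ≠ ℓ₂ ∧ n₁.Coprime n₂ ∧ (n₁ * n₂).Coprime (ℓ₁ * ℓ₂)) then
          γ n₁ * (starRingEnd ℂ) (γ n₂) * ∑ c ∈ Cb, Ψ c n₁ n₂ * Sd ℓ₁ ℓ₂ n₁ n₂ c else 0) := by
    rw [kfd_sum_comm5]
    refine Finset.sum_congr rfl fun ℓ₁ hℓ₁ => Finset.sum_congr rfl fun n₁ hn₁ =>
      Finset.sum_congr rfl fun ℓ₂ hℓ₂ => Finset.sum_congr rfl fun n₂ hn₂ => ?_
    rw [Finset.sum_ite_irrel, Finset.sum_const_zero]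
    by_cases hndc : ℓ₁ ≠ ℓ₂ ∧ n₁.Coprime n₂ ∧ (n₁ * n₂).Coprime (ℓ₁ * ℓ₂)
    · rw [if_pos hndc, if_pos hndc]
      obtain ⟨hne, hn, hnl⟩ := hndc
      have hn₁0 : 0 < n₁ := (Finset.mem_Icc.mp hn₁).1
      have hn₂0 : 0 < n₂ := (Finset.mem_Icc.mp hn₂).1
      by_cases hγ0 : γ n₁ = 0 ∨ γ n₂ = 0
      · -- both sides vanish
        have hz : ∀ m, (if (ℓ₂ * n₂).Coprime m ∧ ((ℓ₁ * n₁ : ℕ) : ZMod m) = ((ℓ₂ * n₂ : ℕ) : ZMod m)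
            then γ n₁ * e k (b * n₁) m * (starRingEnd ℂ) (γ n₂ * e k (b * n₂) m) else 0) = 0 := by
          intro m
          split_ifs
          · rcases hγ0 with h | h <;> simp only [h, zero_mul, mul_zero, map_zero]
          · rfl
        rw [Finset.sum_congr rfl (fun m _ => hz m), Finset.sum_const_zero]
        rcases hγ0 with h | h <;> simp only [h, zero_mul, mul_zero, map_zero]
      · push Not at hγ0
        have hb₁ : n₁.Coprime b := hγb n₁ hγ0.1
        have hb₂ : n₂.Coprime b := hγb n₂ hγ0.2
        have hDw : ((ℓ₁ * n₁ : ℤ) - ℓ₂ * n₂).natAbs ≤ D * (M₁ + 1) := by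
          -- `|w| ≤ max(ℓ₁n₁, ℓ₂n₂) ≤ 2L · 2N' ≤ D(M₁+1)`
          obtain ⟨_, _, hℓ₁L⟩ := h𝓛 ℓ₁ hℓ₁
          obtain ⟨_, _, hℓ₂L⟩ := h𝓛 ℓ₂ hℓ₂
          have hn₁' : (n₁ : ℝ) ≤ 2 * N' := by
            calc (n₁ : ℝ) ≤ ⌊2 * N'⌋₊ := by exact_mod_cast (Finset.mem_Icc.mp hn₁).2
              _ ≤ 2 * N' := Nat.floor_le (by linarith)
          have hn₂' : (n₂ : ℝ) ≤ 2 * N' := by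
            calc (n₂ : ℝ) ≤ ⌊2 * N'⌋₊ := by exact_mod_cast (Finset.mem_Icc.mp hn₂).2
              _ ≤ 2 * N' := Nat.floor_le (by linarith)
          have h1 : ((ℓ₁ * n₁ : ℕ) : ℝ) ≤ 4 * L * N' := by
            have : (ℓ₁ : ℝ) ≤ 2 * L := by exact_mod_cast hℓ₁L
            push_cast; nlinarith [Nat.cast_nonneg (α := ℝ) n₁, Nat.cast_nonneg (α := ℝ) ℓ₁]
          have h2 : ((ℓ₂ * n₂ : ℕ) : ℝ) ≤ 4 * L * N' := by
            have : (ℓ₂ : ℝ) ≤ 2 * L := by exact_mod_cast hℓ₂L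
            push_cast; nlinarith [Nat.cast_nonneg (α := ℝ) n₂, Nat.cast_nonneg (α := ℝ) ℓ₂]
          have hab : Int.natAbs ((ℓ₁ * n₁ : ℤ) - ℓ₂ * n₂) ≤ max (ℓ₁ * n₁) (ℓ₂ * n₂) := by omega
          have hr : ((Int.natAbs ((ℓ₁ * n₁ : ℤ) - ℓ₂ * n₂) : ℕ) : ℝ) ≤ (D : ℝ) * (M₁ + 1) := by
            calc ((Int.natAbs ((ℓ₁ * n₁ : ℤ) - ℓ₂ * n₂) : ℕ) : ℝ)
                ≤ ((max (ℓ₁ * n₁) (ℓ₂ * n₂) : ℕ) : ℝ) := by exact_mod_cast hab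
              _ ≤ 4 * L * N' := by
                  rcases le_total (ℓ₁ * n₁) (ℓ₂ * n₂) with h | h
                  · rw [max_eq_right h]; exact h2
                  · rw [max_eq_left h]; exact h1
              _ ≤ (D : ℝ) * (M₁ + 1) := hD
          exact_mod_cast hr
        have h := kfs_msum_tuple_eq e he k hb γ M₁ M₂ D (h𝓛 ℓ₁ hℓ₁).1 (h𝓛 ℓ₂ hℓ₂).1 hne hn
          hnl hn₁0 hn₂0 hb₁ hb₂ hDw
        rw [h]
    · rw [if_neg hndc, if_neg hndc]
  -- Step C: reorder, `(ℓ₂, n₁, n₂, c)` outside and `ℓ₁` inside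
  have hC : ∑ ℓ₁ ∈ 𝓛, ∑ n₁ ∈ I, ∑ ℓ₂ ∈ 𝓛, ∑ n₂ ∈ I,
      (if (ℓ₁ ≠ ℓ₂ ∧ n₁.Coprime n₂ ∧ (n₁ * n₂).Coprime (ℓ₁ * ℓ₂)) then
        γ n₁ * (starRingEnd ℂ) (γ n₂) * ∑ c ∈ Cb, Ψ c n₁ n₂ * Sd ℓ₁ ℓ₂ n₁ n₂ c else 0) =
      ∑ ℓ₂ ∈ 𝓛, ∑ n₁ ∈ I, ∑ n₂ ∈ I, ∑ c ∈ Cb,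
        (γ n₁ * (starRingEnd ℂ) (γ n₂) * Ψ c n₁ n₂) * V ℓ₂ n₁ n₂ c := by
    -- move `ℓ₁` inside
    rw [Finset.sum_comm]
    have step1 : ∀ n₁ ∈ I, ∑ ℓ₁ ∈ 𝓛, ∑ ℓ₂ ∈ 𝓛, ∑ n₂ ∈ I,
        (if (ℓ₁ ≠ ℓ₂ ∧ n₁.Coprime n₂ ∧ (n₁ * n₂).Coprime (ℓ₁ * ℓ₂)) then
          γ n₁ * (starRingEnd ℂ) (γ n₂) * ∑ c ∈ Cb, Ψ c n₁ n₂ * Sd ℓ₁ ℓ₂ n₁ n₂ c else 0) =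
        ∑ ℓ₂ ∈ 𝓛, ∑ n₂ ∈ I, ∑ c ∈ Cb,
          (γ n₁ * (starRingEnd ℂ) (γ n₂) * Ψ c n₁ n₂) * V ℓ₂ n₁ n₂ c := by
      intro n₁ _
      rw [Finset.sum_comm]
      refine Finset.sum_congr rfl fun ℓ₂ _ => ?_
      rw [Finset.sum_comm]
      refine Finset.sum_congr rfl fun n₂ _ => ?_
      -- `∑_{ℓ₁} [NDC] γγ̄ ∑_c Ψ Sd = ∑_c γγ̄ Ψ ∑_{ℓ₁} [NDC] Sd`
      simp only [hV]
      have : ∀ ℓ₁ ∈ 𝓛, (if (ℓ₁ ≠ ℓ₂ ∧ n₁.Coprime n₂ ∧ (n₁ * n₂).Coprime (ℓ₁ * ℓ₂)) then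
          γ n₁ * (starRingEnd ℂ) (γ n₂) * ∑ c ∈ Cb, Ψ c n₁ n₂ * Sd ℓ₁ ℓ₂ n₁ n₂ c else 0) =
          ∑ c ∈ Cb, (γ n₁ * (starRingEnd ℂ) (γ n₂) * Ψ c n₁ n₂) *
            (if (ℓ₁ ≠ ℓ₂ ∧ n₁.Coprime n₂ ∧ (n₁ * n₂).Coprime (ℓ₁ * ℓ₂)) then
              Sd ℓ₁ ℓ₂ n₁ n₂ c else 0) := by
        intro ℓ₁ _
        split_ifs
        · rw [Finset.mul_sum]
          exact Finset.sum_congr rfl fun c _ => by ring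
        · simp
      rw [Finset.sum_congr rfl this, Finset.sum_comm]
      refine Finset.sum_congr rfl fun c _ => ?_
      rw [Finset.mul_sum]
    rw [Finset.sum_congr rfl step1, Finset.sum_comm]
  -- drop the `n₁`, `n₂` with `γ = 0`
  set I' := I.filter (fun n => γ n ≠ 0) with hI'
  have hdrop : ∑ ℓ₂ ∈ 𝓛, ∑ n₁ ∈ I, ∑ n₂ ∈ I, ∑ c ∈ Cb,
      (γ n₁ * (starRingEnd ℂ) (γ n₂) * Ψ c n₁ n₂) * V ℓ₂ n₁ n₂ c =
      ∑ ℓ₂ ∈ 𝓛, ∑ n₁ ∈ I', ∑ n₂ ∈ I', ∑ c ∈ Cb,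
      (γ n₁ * (starRingEnd ℂ) (γ n₂) * Ψ c n₁ n₂) * V ℓ₂ n₁ n₂ c := by
    refine Finset.sum_congr rfl fun ℓ₂ _ => ?_
    rw [hI', Finset.sum_filter]
    refine Finset.sum_congr rfl fun n₁ _ => ?_
    split_ifs with h
    · rw [Finset.sum_filter]
      refine Finset.sum_congr rfl fun n₂ _ => ?_
      split_ifs with h'
      · rfl
      · push Not at h'
        simp only [h', map_zero, mul_zero, zero_mul, Finset.sum_const_zero]
    · push Not at h
      simp only [h, zero_mul, Finset.sum_const_zero]
  rw [hAB, hC, hdrop]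
  -- Step D: Cauchy–Schwarz
  refine (kfs_norm_sum4_mul_le 𝓛 I' I' Cb
    (fun ℓ₂ n₁ n₂ c => γ n₁ * (starRingEnd ℂ) (γ n₂) * Ψ c n₁ n₂)
    (fun ℓ₂ n₁ n₂ c => V ℓ₂ n₁ n₂ c)).trans ?_
  -- the weight sum: `∑ ‖γγ̄Ψ‖² = #𝓛 · (∑' ‖γ‖²) · (∑' ‖γ‖²) · #Cb ≤ #𝓛 #Cb ‖γ‖⁴`
  have hsub : ∑ n₁ ∈ I', ‖γ n₁‖ ^ 2 ≤ ∑ n ∈ I, ‖γ n‖ ^ 2 :=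
    Finset.sum_le_sum_of_subset_of_nonneg (Finset.filter_subset _ _) fun _ _ _ => sq_nonneg _
  have h0' : 0 ≤ ∑ n ∈ I', ‖γ n‖ ^ 2 := Finset.sum_nonneg fun _ _ => sq_nonneg _
  have h0 : 0 ≤ ∑ n ∈ I, ‖γ n‖ ^ 2 := Finset.sum_nonneg fun _ _ => sq_nonneg _
  have hw : ∑ ℓ₂ ∈ 𝓛, ∑ n₁ ∈ I', ∑ n₂ ∈ I', ∑ c ∈ Cb,
      ‖γ n₁ * (starRingEnd ℂ) (γ n₂) * Ψ c n₁ n₂‖ ^ 2 ≤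
      (𝓛.card * Cb.card) * (∑ n ∈ I, ‖γ n‖ ^ 2) ^ 2 := by
    have hterm : ∀ n₁ n₂ c, ‖γ n₁ * (starRingEnd ℂ) (γ n₂) * Ψ c n₁ n₂‖ ^ 2 =
        ‖γ n₁‖ ^ 2 * ‖γ n₂‖ ^ 2 := by
      intro n₁ n₂ c
      rw [norm_mul, norm_mul, RCLike.norm_conj, hΨn, mul_one, mul_pow]
    simp_rw [hterm]
    have hinner : ∀ n₁, ∑ n₂ ∈ I', ∑ c ∈ Cb, ‖γ n₁‖ ^ 2 * ‖γ n₂‖ ^ 2 =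
        Cb.card * (‖γ n₁‖ ^ 2 * ∑ n ∈ I', ‖γ n‖ ^ 2) := by
      intro n₁
      calc ∑ n₂ ∈ I', ∑ c ∈ Cb, ‖γ n₁‖ ^ 2 * ‖γ n₂‖ ^ 2
          = ∑ n₂ ∈ I', (Cb.card : ℝ) * (‖γ n₁‖ ^ 2 * ‖γ n₂‖ ^ 2) := by
            refine Finset.sum_congr rfl fun n₂ _ => ?_
            rw [Finset.sum_const, nsmul_eq_mul]
        _ = Cb.card * (‖γ n₁‖ ^ 2 * ∑ n ∈ I', ‖γ n‖ ^ 2) := by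
            rw [Finset.mul_sum, Finset.mul_sum]
    simp_rw [hinner]
    rw [Finset.sum_const, nsmul_eq_mul, ← Finset.mul_sum, ← Finset.sum_mul]
    have hc : (0 : ℝ) ≤ 𝓛.card := Nat.cast_nonneg _
    have hc' : (0 : ℝ) ≤ Cb.card := Nat.cast_nonneg _
    calc (𝓛.card : ℝ) * (Cb.card * ((∑ n₁ ∈ I', ‖γ n₁‖ ^ 2) * ∑ n ∈ I', ‖γ n‖ ^ 2))
        ≤ 𝓛.card * (Cb.card * ((∑ n ∈ I, ‖γ n‖ ^ 2) * ∑ n ∈ I, ‖γ n‖ ^ 2)) :=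
          mul_le_mul_of_nonneg_left (mul_le_mul_of_nonneg_left
            (mul_le_mul hsub hsub h0' h0) hc') hc
      _ = (𝓛.card * Cb.card) * (∑ n ∈ I, ‖γ n‖ ^ 2) ^ 2 := by ring
  have hsqrt : Real.sqrt (∑ ℓ₂ ∈ 𝓛, ∑ n₁ ∈ I', ∑ n₂ ∈ I', ∑ c ∈ Cb,
      ‖γ n₁ * (starRingEnd ℂ) (γ n₂) * Ψ c n₁ n₂‖ ^ 2) ≤
      (∑ n ∈ I, ‖γ n‖ ^ 2) * Real.sqrt (𝓛.card * Cb.card) := by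
    calc Real.sqrt (∑ ℓ₂ ∈ 𝓛, ∑ n₁ ∈ I', ∑ n₂ ∈ I', ∑ c ∈ Cb,
          ‖γ n₁ * (starRingEnd ℂ) (γ n₂) * Ψ c n₁ n₂‖ ^ 2)
        ≤ Real.sqrt ((𝓛.card * Cb.card) * (∑ n ∈ I, ‖γ n‖ ^ 2) ^ 2) := Real.sqrt_le_sqrt hw
      _ = Real.sqrt (𝓛.card * Cb.card) * (∑ n ∈ I, ‖γ n‖ ^ 2) := by
          rw [Real.sqrt_mul (mul_nonneg (Nat.cast_nonneg _) (Nat.cast_nonneg _)), Real.sqrt_sq h0]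
      _ = (∑ n ∈ I, ‖γ n‖ ^ 2) * Real.sqrt (𝓛.card * Cb.card) := by ring
  have hV0 : 0 ≤ Real.sqrt (∑ ℓ₂ ∈ 𝓛, ∑ n₁ ∈ I', ∑ n₂ ∈ I', ∑ c ∈ Cb, ‖V ℓ₂ n₁ n₂ c‖ ^ 2) :=
    Real.sqrt_nonneg _
  calc Real.sqrt (∑ ℓ₂ ∈ 𝓛, ∑ n₁ ∈ I', ∑ n₂ ∈ I', ∑ c ∈ Cb,
          ‖γ n₁ * (starRingEnd ℂ) (γ n₂) * Ψ c n₁ n₂‖ ^ 2) *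
        Real.sqrt (∑ ℓ₂ ∈ 𝓛, ∑ n₁ ∈ I', ∑ n₂ ∈ I', ∑ c ∈ Cb, ‖V ℓ₂ n₁ n₂ c‖ ^ 2)
      ≤ ((∑ n ∈ I, ‖γ n‖ ^ 2) * Real.sqrt (𝓛.card * Cb.card)) *
        Real.sqrt (∑ ℓ₂ ∈ 𝓛, ∑ n₁ ∈ I', ∑ n₂ ∈ I', ∑ c ∈ Cb, ‖V ℓ₂ n₁ n₂ c‖ ^ 2) :=
        mul_le_mul_of_nonneg_right hsqrt hV0
    _ = _ := by rfl

end Phase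

end Literature.NumberTheory.LFunctions

end
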